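import Summits.CriticalPhenomena.Ising3DConformalLimit.Theorems.AnomalousForcesInteractionGaussianLimitIsFreeGaussMarkovRigidity
import Literature.MathematicalPhysics.QuantumLattice.GermMarkov
import HarnessLib

/-!
# Crux `GaussianLimitIsFree` (item stmt-CriticalPhenomena-2601), line `registered` (birth v6):
# conditional independence in splitting form ⟹ one-sided Markov form and a covariance bound

THEOREM-ONLY helper file (lead c3) for the direct germ-form rigidity proof of stub 3
(`stub_gaussMarkovRigidity`) of the skeleton `Cruxes/GaussianLimitIsFree/Lines/birth.lean` (v6):

* `condExp_indicator_eq_of_condIndepCondExp`, `condExp_eq_of_condIndepCondExp` — if `m'` splits `m₁` and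
  `m₂` (`CondIndepCondExp`, Rozanov's (1.1)) and `m' ≤ m₂`, then `E[X | m₂] = E[X | m']` for every
  integrable `m₁`-measurable `X` (Rozanov 1982, Ch. 2 §1.1, (1.1) ⇒ (1.3); indicators first — the
  candidate `E[1_s | m']` has the right integrals on `m₂`-sets by the pull-out property and the splitting
  identity — then `MemLp.induction_stronglyMeasurable` with the `L¹`-continuity of `condExpL1CLM`);
  this is the converse of `condIndepCondExp_of_condExp_indicator_eq`
  (Theorems/…BridgeFromMarkovInheritance.lean);
* `integral_mul_eq_integral_condExp_mul`, `abs_integral_mul_le_of_condIndepCondExp` — hence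
  `∫ X Y = ∫ E[X|m'] Y` and `|∫ X Y| ≤ ‖E[X | m']‖₂ ‖Y‖₂` for `L²` variables `X ∈ m₁`, `Y ∈ m₂`
  (`abs_integral_mul_le_sqrt_mul_sqrt` is Cauchy–Schwarz in the real-integral form used downstream).

In the rigidity proof `m' = germSigma (sphere 0 1)`, `m₁ = germSigma (closedBall 0 1) ∋ σ(ω w)`,
`m₂ = germSigma (ball 0 1)ᶜ ∋ σ(ω v)`, and `‖E[ω w | m']‖₂` is shown to vanish for a radial `w` whose Riesz
potential vanishes on the sphere.

References: Yu. A. Rozanov, *Markov Random Fields* (Springer 1982), Ch. 2 §1.1 (1.1)–(1.3).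
-/

noncomputable section

namespace Summit.CriticalPhenomena.Ising3DConformalLimit.Cruxes.GaussianLimitIsFree.Birth

open MeasureTheory Filter Set
open scoped ProbabilityTheory Topology ENNReal
open Literature.MathematicalPhysics.QuantumLattice

/-! ### Part 1 — one-sided Markov form of a splitting and the covariance bound -/

section OneSided

variable {Ω : Type*} {m' m₁ m₂ mΩ : MeasurableSpace Ω} {μ : Measure Ω}

/-- **Splitting ⟹ one-sided Markov, indicators** (Rozanov 1982, Ch. 2 §1.1, (1.1) ⇒ (1.3)): if `m'`
splits `m₁` and `m₂` and `m' ≤ m₂`, then `μ⟦s | m₂⟧ = μ⟦s | m'⟧` a.e. for every `s ∈ m₁`.  Proof: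
`μ⟦s | m'⟧` is `m₂`-measurable and has the right integrals on `m₂`-sets `t`:
`∫ 1_t μ⟦s|m'⟧ = ∫ μ⟦t|m'⟧ μ⟦s|m'⟧ = ∫ μ⟦s ∩ t|m'⟧ = μ(s ∩ t)`. [cite: Rozanov1982, Ch. 2 §1.1 (1.1)–(1.3)] -/
theorem condExp_indicator_eq_of_condIndepCondExp [IsFiniteMeasure μ] (hm' : m' ≤ mΩ)
    (hm₁ : m₁ ≤ mΩ) (hm₂ : m₂ ≤ mΩ) (hle : m' ≤ m₂) (h : CondIndepCondExp m' m₁ m₂ μ)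
    {s : Set Ω} (hs : MeasurableSet[m₁] s) :
    μ[s.indicator (fun _ => (1:ℝ)) | m₂] =ᵐ[μ] μ[s.indicator (fun _ => (1:ℝ)) | m'] := by
  set fs : Ω → ℝ := s.indicator (fun _ => (1 : ℝ)) with hfs
  have hsΩ : MeasurableSet s := hm₁ s hs
  have hfs_int : Integrable fs μ := (integrable_const (1 : ℝ)).indicator hsΩ
  have hcond_meas : StronglyMeasurable[m'] (μ[fs | m']) := stronglyMeasurable_condExp
  have hcond_bound : ∀ᵐ ω ∂μ, ‖(μ[fs | m']) ω‖ ≤ 1 := by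
    have hup : μ[fs | m'] ≤ᵐ[μ] μ[(fun _ => (1 : ℝ)) | m'] :=
      condExp_mono hfs_int (integrable_const _) (Eventually.of_forall fun ω => by
        rw [hfs]; by_cases hω : ω ∈ s <;> simp [Set.indicator, hω])
    have hlo : μ[(fun _ => (0 : ℝ)) | m'] ≤ᵐ[μ] μ[fs | m'] :=
      condExp_mono (integrable_const _) hfs_int (Eventually.of_forall fun ω => by
        rw [hfs]; by_cases hω : ω ∈ s <;> simp [Set.indicator, hω])
    filter_upwards [hup, hlo] with ω hωu hωl
    rw [condExp_const hm' (1 : ℝ)] at hωu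
    rw [condExp_const hm' (0 : ℝ)] at hωl
    rw [Real.norm_eq_abs, abs_le]
    exact ⟨by linarith, hωu⟩
  symm
  refine ae_eq_condExp_of_forall_setIntegral_eq hm₂ hfs_int
    (fun t _ _ => integrable_condExp.integrableOn) ?_
    (hcond_meas.mono hle).aestronglyMeasurable
  intro t ht _
  have htΩ : MeasurableSet t := hm₂ t ht
  set ft : Ω → ℝ := t.indicator (fun _ => (1 : ℝ)) with hft
  have hft_int : Integrable ft μ := (integrable_const (1 : ℝ)).indicator htΩ
  have e1 : ∫ x in t, (μ[fs | m']) x ∂μ = ∫ x, (ft * μ[fs | m']) x ∂μ := by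
    rw [← integral_indicator htΩ]
    refine integral_congr_ae (Eventually.of_forall fun x => ?_)
    simp only [Pi.mul_apply, hft]
    by_cases hx : x ∈ t <;> simp [hx]
  have e2 : ∫ x in t, fs x ∂μ = ∫ x, (s ∩ t).indicator (fun _ => (1 : ℝ)) x ∂μ := by
    rw [← integral_indicator htΩ]
    refine integral_congr_ae (Eventually.of_forall fun x => ?_)
    simp only [hfs]
    by_cases h1 : x ∈ s <;> by_cases h2 : x ∈ t <;> simp [h1, h2]
  rw [e1, e2]
  have h3 : μ[ft * μ[fs | m'] | m'] =ᵐ[μ] μ[fs | m'] * μ[ft | m'] := by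
    have hcomm : ft * μ[fs | m'] = μ[fs | m'] * ft := mul_comm _ _
    rw [hcomm]
    exact condExp_stronglyMeasurable_mul_of_bound hm' hcond_meas hft_int 1 hcond_bound
  have h4 : μ[fs | m'] * μ[ft | m'] =ᵐ[μ] μ[(s ∩ t).indicator (fun _ => (1 : ℝ)) | m'] := by
    filter_upwards [h s t hs ht] with x hx
    rw [hx]
  calc ∫ x, (ft * μ[fs | m']) x ∂μ = ∫ x, (μ[ft * μ[fs | m'] | m']) x ∂μ :=
        (integral_condExp hm').symm
    _ = ∫ x, (μ[(s ∩ t).indicator (fun _ => (1 : ℝ)) | m']) x ∂μ :=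
        integral_congr_ae (h3.trans h4)
    _ = ∫ x, (s ∩ t).indicator (fun _ => (1 : ℝ)) x ∂μ := integral_condExp hm'

/-- **Splitting ⟹ one-sided Markov, functions**: if `m'` splits `m₁` and `m₂` and `m' ≤ m₂`, then
`E[X | m₂] = E[X | m']` a.e. for every integrable, `m₁`-(a.e. strongly) measurable real `X` (from the
indicator case by linearity, `L¹`-continuity of the conditional expectation and
`MemLp.induction_stronglyMeasurable`). [cite: Rozanov1982, Ch. 2 §1.1 (1.1)–(1.3)] -/
theorem condExp_eq_of_condIndepCondExp [IsFiniteMeasure μ] (hm' : m' ≤ mΩ)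
    (hm₁ : m₁ ≤ mΩ) (hm₂ : m₂ ≤ mΩ) (hle : m' ≤ m₂) (h : CondIndepCondExp m' m₁ m₂ μ)
    {X : Ω → ℝ} (hX : Integrable X μ) (hXm : AEStronglyMeasurable[m₁] X μ) :
    μ[X | m₂] =ᵐ[μ] μ[X | m'] := by
  have hX1 : MemLp X 1 μ := memLp_one_iff_integrable.2 hX
  refine MemLp.induction_stronglyMeasurable (μ := μ) (F := ℝ) hm₁ ENNReal.one_ne_top
    (fun X : Ω → ℝ => μ[X | m₂] =ᵐ[μ] μ[X | m']) ?_ ?_ ?_ ?_ hX1 hXm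
  · -- multiples of indicators of `m₁`-sets
    intro c s hs _
    have h1 := condExp_indicator_eq_of_condIndepCondExp hm' hm₁ hm₂ hle h hs
    have hsc : (s.indicator fun _ => c) = c • s.indicator (fun _ => (1 : ℝ)) := by
      funext x
      by_cases hx : x ∈ s <;> simp [hx]
    rw [hsc]
    refine (condExp_smul c _ m₂).trans ?_
    refine EventuallyEq.trans ?_ (condExp_smul c _ m').symm
    filter_upwards [h1] with x hx
    simp only [Pi.smul_apply, hx]
  · -- additivity
    intro f g _ hf hg _ _ hPf hPg
    have hfi : Integrable f μ := memLp_one_iff_integrable.1 hf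
    have hgi : Integrable g μ := memLp_one_iff_integrable.1 hg
    exact (condExp_add hfi hgi m₂).trans ((hPf.add hPg).trans (condExp_add hfi hgi m').symm)
  · -- closedness in `lpMeas ℝ ℝ m₁ 1 μ`
    have heq : {f : lpMeas ℝ ℝ m₁ 1 μ | μ[((f : Lp ℝ 1 μ) : Ω → ℝ) | m₂] =ᵐ[μ]
          μ[((f : Lp ℝ 1 μ) : Ω → ℝ) | m']} =
        {f : lpMeas ℝ ℝ m₁ 1 μ | condExpL1CLM ℝ hm₂ μ (f : Lp ℝ 1 μ) =
          condExpL1CLM ℝ hm' μ (f : Lp ℝ 1 μ)} := by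
      ext f
      simp only [Set.mem_setOf_eq]
      have hfi : Integrable ((f : Lp ℝ 1 μ) : Ω → ℝ) μ := L1.integrable_coeFn _
      have h2 := condExp_ae_eq_condExpL1CLM hm₂ hfi
      have h' := condExp_ae_eq_condExpL1CLM hm' hfi
      rw [Integrable.toL1_coeFn] at h2 h'
      constructor
      · intro hP
        exact Lp.ext (h2.symm.trans (hP.trans h'))
      · intro hE
        have hE' : ((condExpL1CLM ℝ hm₂ μ (f : Lp ℝ 1 μ) : Lp ℝ 1 μ) : Ω → ℝ) =ᵐ[μ]
            ((condExpL1CLM ℝ hm' μ (f : Lp ℝ 1 μ) : Lp ℝ 1 μ) : Ω → ℝ) := by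
          rw [hE]
        exact h2.trans (hE'.trans h'.symm)
    change IsClosed {f : lpMeas ℝ ℝ m₁ 1 μ | μ[((f : Lp ℝ 1 μ) : Ω → ℝ) | m₂] =ᵐ[μ]
          μ[((f : Lp ℝ 1 μ) : Ω → ℝ) | m']}
    rw [heq]
    exact isClosed_eq ((condExpL1CLM ℝ hm₂ μ).continuous.comp continuous_subtype_val)
      ((condExpL1CLM ℝ hm' μ).continuous.comp continuous_subtype_val)
  · -- invariance under a.e. equality
    intro f g hfg _ hPf
    exact (condExp_congr_ae hfg.symm).trans (hPf.trans (condExp_congr_ae hfg))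

/-- **Covariance identity from a splitting**: with `m'` splitting `m₁`, `m₂`, `m' ≤ m₂`, `X ∈ L²`
`m₁`-measurable and `Y ∈ L²` `m₂`-measurable, `∫ X Y = ∫ E[X | m'] Y` (tower through `m₂`, pull-out of
`Y`, one-sided Markov form). [cite: Rozanov1982, Ch. 2 §1.1 (1.1)–(1.3)] -/
theorem integral_mul_eq_integral_condExp_mul [IsFiniteMeasure μ] (hm' : m' ≤ mΩ)
    (hm₁ : m₁ ≤ mΩ) (hm₂ : m₂ ≤ mΩ) (hle : m' ≤ m₂) (h : CondIndepCondExp m' m₁ m₂ μ)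
    {X Y : Ω → ℝ} (hXm : AEStronglyMeasurable[m₁] X μ) (hYm : StronglyMeasurable[m₂] Y)
    (hX2 : MemLp X 2 μ) (hY2 : MemLp Y 2 μ) :
    ∫ ω, X ω * Y ω ∂μ = ∫ ω, (μ[X | m']) ω * Y ω ∂μ := by
  have hXi : Integrable X μ := hX2.integrable one_le_two
  have hXY : Integrable (X * Y) μ := hX2.integrable_mul hY2
  have h1 : ∫ ω, X ω * Y ω ∂μ = ∫ ω, (μ[X * Y | m₂]) ω ∂μ := (integral_condExp hm₂).symm
  have h2 : μ[X * Y | m₂] =ᵐ[μ] μ[X | m₂] * Y := condExp_mul_of_stronglyMeasurable_right hYm hXY hXi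
  have h3 : μ[X | m₂] =ᵐ[μ] μ[X | m'] := condExp_eq_of_condIndepCondExp hm' hm₁ hm₂ hle h hXi hXm
  rw [h1]
  refine integral_congr_ae ?_
  filter_upwards [h2, h3] with ω h2ω h3ω
  rw [h2ω, Pi.mul_apply, h3ω]

/-- Cauchy–Schwarz for real `L²` functions in the form `|∫ f g| ≤ (∫ f²)^{1/2} (∫ g²)^{1/2}`.
[folklore] -/
theorem abs_integral_mul_le_sqrt_mul_sqrt {f g : Ω → ℝ} (hf : MemLp f 2 μ) (hg : MemLp g 2 μ) :
    |∫ x, f x * g x ∂μ| ≤ Real.sqrt (∫ x, f x ^ 2 ∂μ) * Real.sqrt (∫ x, g x ^ 2 ∂μ) := by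
  have h1 : |∫ x, f x * g x ∂μ| ≤ ∫ x, |f x| * |g x| ∂μ := by
    calc |∫ x, f x * g x ∂μ| = ‖∫ x, f x * g x ∂μ‖ := (Real.norm_eq_abs _).symm
      _ ≤ ∫ x, ‖f x * g x‖ ∂μ := norm_integral_le_integral_norm _
      _ = ∫ x, |f x| * |g x| ∂μ := by
          refine integral_congr_ae (Eventually.of_forall fun x => ?_)
          simp only [Real.norm_eq_abs, abs_mul]
  have hf' : MemLp (fun x => |f x|) (ENNReal.ofReal 2) μ := by
    rw [ENNReal.ofReal_ofNat]; exact hf.abs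
  have hg' : MemLp (fun x => |g x|) (ENNReal.ofReal 2) μ := by
    rw [ENNReal.ofReal_ofNat]; exact hg.abs
  have h2 := integral_mul_le_Lp_mul_Lq_of_nonneg Real.HolderConjugate.two_two
    (Eventually.of_forall fun x => abs_nonneg (f x)) (Eventually.of_forall fun x => abs_nonneg (g x))
    hf' hg'
  have e1 : (∫ x, |f x| ^ (2 : ℝ) ∂μ) ^ (1 / (2 : ℝ)) = Real.sqrt (∫ x, f x ^ 2 ∂μ) := by
    rw [Real.sqrt_eq_rpow]
    congr 1
    refine integral_congr_ae (Eventually.of_forall fun x => ?_)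
    simp only [Real.rpow_two, sq_abs]
  have e2 : (∫ x, |g x| ^ (2 : ℝ) ∂μ) ^ (1 / (2 : ℝ)) = Real.sqrt (∫ x, g x ^ 2 ∂μ) := by
    rw [Real.sqrt_eq_rpow]
    congr 1
    refine integral_congr_ae (Eventually.of_forall fun x => ?_)
    simp only [Real.rpow_two, sq_abs]
  rw [e1, e2] at h2
  exact h1.trans h2

/-- **Covariance bound from a splitting**: with `m'` splitting `m₁`, `m₂`, `m' ≤ m₂`, for `X ∈ L²`
`m₁`-measurable and `Y ∈ L²` `m₂`-measurable, `|∫ X Y| ≤ (∫ E[X|m']²)^{1/2} (∫ Y²)^{1/2}`.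
[cite: Rozanov1982, Ch. 2 §1.1 (1.1)–(1.3)] -/
theorem abs_integral_mul_le_of_condIndepCondExp [IsFiniteMeasure μ] (hm' : m' ≤ mΩ)
    (hm₁ : m₁ ≤ mΩ) (hm₂ : m₂ ≤ mΩ) (hle : m' ≤ m₂) (h : CondIndepCondExp m' m₁ m₂ μ)
    {X Y : Ω → ℝ} (hXm : AEStronglyMeasurable[m₁] X μ) (hYm : StronglyMeasurable[m₂] Y)
    (hX2 : MemLp X 2 μ) (hY2 : MemLp Y 2 μ) :
    |∫ ω, X ω * Y ω ∂μ| ≤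
      Real.sqrt (∫ ω, (μ[X | m']) ω ^ 2 ∂μ) * Real.sqrt (∫ ω, Y ω ^ 2 ∂μ) := by
  rw [integral_mul_eq_integral_condExp_mul hm' hm₁ hm₂ hle h hXm hYm hX2 hY2]
  exact abs_integral_mul_le_sqrt_mul_sqrt (hX2.condExp one_le_two) hY2

end OneSided

/-- **Registered form (crux stmt-CriticalPhenomena-2601, line `registered`, skeleton v6): the covariance
bound on `𝒮'(ℝ³)`.**  For a finite measure `μ` on `FieldConfig ℝ³`, sub-σ-algebras `m', m₁, m₂` of its Borel
σ-algebra with `m'` splitting `m₁`, `m₂` and `m' ≤ m₂` (the measure is quantified FIRST so that every later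
`Measure`/`condExp`/integral refers to the Borel σ-algebra and not to the bound `mᵢ`), and real `L²` variables `X` (`m₁`-measurable),
`Y` (`m₂`-measurable): `|∫ X Y dμ| ≤ (∫ E[X | m']² dμ)^{1/2} (∫ Y² dμ)^{1/2}`.
[cite: Rozanov1982, Ch. 2 §1.1 (1.1)–(1.3)] -/
theorem stub_condIndep_covariance_bound :
    ∀ (μ : MeasureTheory.Measure (Literature.MathematicalPhysics.QuantumLattice.FieldConfig (EuclideanSpace ℝ (Fin 3))))
      [MeasureTheory.IsFiniteMeasure μ]
      (m' m₁ m₂ : MeasurableSpace (Literature.MathematicalPhysics.QuantumLattice.FieldConfig (EuclideanSpace ℝ (Fin 3)))),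
      m' ≤ Literature.MathematicalPhysics.QuantumLattice.FieldConfig.instMeasurableSpace →
      m₁ ≤ Literature.MathematicalPhysics.QuantumLattice.FieldConfig.instMeasurableSpace →
      m₂ ≤ Literature.MathematicalPhysics.QuantumLattice.FieldConfig.instMeasurableSpace →
      m' ≤ m₂ →
      Literature.MathematicalPhysics.QuantumLattice.CondIndepCondExp m' m₁ m₂ μ →
      ∀ (X Y : Literature.MathematicalPhysics.QuantumLattice.FieldConfig (EuclideanSpace ℝ (Fin 3)) → ℝ),
        Measurable[m₁] X → Measurable[m₂] Y → MeasureTheory.MemLp X 2 μ → MeasureTheory.MemLp Y 2 μ →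
        |∫ ω, X ω * Y ω ∂μ| ≤
          Real.sqrt (∫ ω, (MeasureTheory.condExp m' μ X) ω ^ 2 ∂μ) * Real.sqrt (∫ ω, Y ω ^ 2 ∂μ) :=
  by
  intro μ _ m' m₁ m₂ hm' hm₁ hm₂ hle h X Y hX hY hX2 hY2
  exact abs_integral_mul_le_of_condIndepCondExp hm' hm₁ hm₂ hle h
    hX.stronglyMeasurable.aestronglyMeasurable hY.stronglyMeasurable hX2 hY2

end Summit.CriticalPhenomena.Ising3DConformalLimit.Cruxes.GaussianLimitIsFree.Birth

end
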